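import Summits.QuantumFields.YangMills.Theorems.FluctuationComparisonRegPrIntLS2BetaGeodesicInterpolationSU2
import Summits.QuantumFields.YangMills.Theorems.FluctuationComparisonRegPrIntLS2BetaTwoLegFilling
import Summits.QuantumFields.YangMills.Theorems.FluctuationComparisonRegPrIntLS2BetaDistributedHolonomySU2
import HarnessLib

/-!
# S2β · (RES-u.7)₁ «THE CUBE INTERPOLANT» — successive geodesic interpolation of a cube of `SU(2)` corner data: corner, GLUING faces, and steps `≤ 2π·τ∕n`
# when the twelve edge chords are `≤ τ ≤ 1∕8` (the local engine of ⧗`…S2BetaLipschitzLift.exists_lipschitzLift`, (RES-u.7) «THE LIPSCHITZ LIFT EXISTS»)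

Cell `ym3-torus` (YM ladder rung R3 = continuum `SU(2)` Yang–Mills on the three-torus at fixed lattice data — a RUNG: NOT d = 4, NOT infinite volume,
NOT a mass gap, NOT Clay).  Width seat «width 21» `ym3-torus-px21` (gen 26), FREE px helper on crux `stmt-QuantumFields-20520`
(`…Theses.UnitScaleTilt.FluctuationComparisonRegPrIntL`), LINE g18-1 S2β; pen (RES-u.7) of desk WORD №709∕architect px17 g23 «E_J-FACE» exit (a)
(my COUNT 2026-09-01T01:58Z: at the BLOCK-CONSTANT lift `liftTransfTo t` the top-face fine bonds carry the whole coarse jump `τ′`, so every fine-bond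
letter read at the moved triple is `O(window)`, not `O(window·L^{−(K−J)})` — hence a LIPSCHITZ lift is wanted).
`--kind proof --supports stmt-QuantumFields-20520 --as helper`, count-neutral, DEFINITION-FREE (0 `def`, 0 `instance`, 0 `notation`, 0 `sorry`, default heartbeats).

WHAT IS PROVED (sorry-free; `SU2 = Matrix.specialUnitaryGroup (Fin 2) ℂ`, `dist1` the operator-norm distance to `1`, `seg(m,a,s) := m·expPoint(s•logVec(su2Quat(m⁻¹a)))`
the minimal geodesic from `m` (`s = 0`) to `a` (`s = 1`), ✓`…GeodesicInterpolationSU2`).  §1 SEGMENTS: `arc_le_of_dist1` (`‖logVec(m⁻¹a)‖ ≤ (π∕2)·dist1(a·m⁻¹)`,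
✓`norm_logVec_le_pi_div_two_mul_dist1`); ★`dist1_seg_succ_le`: consecutive points of the `n`-step segment are within `(π∕2)·dist1(a·m⁻¹)∕n`; ★★`dist1_seg_seg_le`:
two segments `m→a`, `m′→a′` with the four cross arcs `≤ π∕2` are, at every common `s ∈ [0,1]`, within `dist1(a·a′⁻¹) + dist1(m·m′⁻¹)` — FACTOR ONE, by the
hemisphere lemmas ✓`dist1_interp_transverse_le_hemisphere` ∘ ✓`dist1_interp_commonTarget_le_hemisphere`; ★★`dist1_seg_seg_le_chord`: the same from CHORD
hypotheses `dist1(a·m⁻¹), dist1(a′·m′⁻¹) ≤ δ`, `dist1(m′·m⁻¹), dist1(a′·a⁻¹) ≤ ε`, `δ + ε ≤ 1` ⟹ `≤ 2ε`; `dist1_seg_base_le` (position along a segment).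
§2 ★★★**`exists_cubeInterpolant (hn : 0 < n) (hτ0 : 0 ≤ τ) (hτ : τ ≤ 1∕8)`**: `∃ I : (ℕ→ℕ→ℕ→SU2) → ℕ→ℕ→ℕ→SU2, ∀ T,` (corner) `I T 0 0 0 = T 0 0 0`; (faces)
`I T n k₁ k₂ = I (T(·+1,·,·)) 0 k₁ k₂`, `I T k₀ n k₂ = I (T(·,·+1,·)) k₀ 0 k₂`, `I T k₀ k₁ n = I (T(·,·,·+1)) k₀ k₁ 0` (UNCONDITIONAL identities: neighbouring cubes of
a lattice of corner data GLUE along their common face); (steps) if the twelve edge chords `dist1(T(e+δ)·T(e)⁻¹)` are `≤ τ` then for `k₀,k₁,k₂ ≤ n` consecutive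
points in each direction are within `dist1 ≤ 2π·τ∕n`.  WITNESS (no `def`; the `fun`-term is displayed in the proof): `P b c k₀ := seg(T0bc, T1bc, k₀∕n)`,
`Q c k₀ k₁ := seg(P0c, P1c, k₁∕n)`, `I T k₀ k₁ k₂ := seg(Q0, Q1, k₂∕n)` — axis 0, then 1, then 2; faces by ✓`leg_zero`∕✓`leg_end`; the chords double per stage
(`τ, 2τ, 4τ`) and the comparisons stay on the hemisphere iff `2·(2τ) + 2·((π∕2)τ∕n) ≤ 1`, which `τ ≤ 1∕8` gives via Mathlib ✓`Real.pi_le_four` — whence the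
constant **`2π`** and the window **`1∕8`**.

HONEST SCOPE.  Elementary geometry of `SU(2) ≅ S³` over landed lemmas (the cited pages are where Bałaban interpolates gauge transformations between
block centres — [Balaban1985RegularSpaces, Lemma 1 p.79, (1.36) p.82]; the statement here is the finite combinatorial version this cell needs, not his);
nothing of Bałaban's renormalisation-group analysis is asserted or proved; GAP♯∘ (`stub_uniformFibreGapOrbit`, registry `Lines/semiclassical_s2beta.lean`
3732b7df UNTOUCHED, 0∕5), S2β, the five registered stubs, crux 20520, 19936, 19200 and `YM3TorusSU2` are NOT proved; no registered stub is closed;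
rung R3 = SU(2) YM₃ on T³ at fixed lattice data — NOT d = 4, NOT infinite volume, NOT a mass gap, NOT Clay; the Yang–Mills mass gap is NOT proved.
-/

set_option autoImplicit false

noncomputable section

namespace Summit.QuantumFields.YangMills.Theorems.FluctuationComparisonRegPrIntLS2BetaCubeInterpolant

open scoped Real
open Literature.MathematicalPhysics.QuantumLattice (su2Quat)
open Literature.MathematicalPhysics.QuantumFieldTheory.Balaban1983to89
open T4CubeChartGnomonic (SU2)
open T4HaarSU2ExpChart (expPoint)
open T4ExpWindowSmallField (logVec)
open Summit.QuantumFields.YangMills.Theorems.FluctuationComparisonRegPrIntLS2BetaGeodesicInterpolationSU2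
  (dist1_interp_step_le dist1_interp_transverse_le_hemisphere dist1_interp_commonTarget_le_hemisphere)
open Summit.QuantumFields.YangMills.Theorems.FluctuationComparisonRegPrIntLS2BetaDistributedHolonomySU2 (norm_logVec_le_pi_div_two_mul_dist1)
open Summit.QuantumFields.YangMills.Theorems.FluctuationComparisonRegPrIntLS2BetaTwoLegFilling (leg_zero leg_end)

/-! ## §1 Geodesic segments in `SU(2)`: steps and the two-segment comparison on the hemisphere -/

/-- Conjugation flips the order inside `dist1`: `dist1 (a⁻¹·b) = dist1 (b·a⁻¹)`. [folklore] -/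
private theorem dist1_inv_mul_eq (a b : SU2) : dist1 (a⁻¹ * b) = dist1 (b * a⁻¹) := by
  rw [show a⁻¹ * b = a⁻¹ * (b * a⁻¹) * a⁻¹⁻¹ by group, GaugeGroup.dist1_conj]

/-- The arc from `m` to `a` is at most `π∕2` times the chord `dist1 (a·m⁻¹)`. [folklore] -/
theorem arc_le_of_dist1 (m a : SU2) : ‖logVec (su2Quat (m⁻¹ * a))‖ ≤ π / 2 * dist1 (a * m⁻¹) := by
  rw [← dist1_inv_mul_eq]; exact norm_logVec_le_pi_div_two_mul_dist1 _

/-- ★ **THE DISCRETE STEP OF A SEGMENT**: consecutive points of the `n`-step geodesic segment from `m` to `a` are within `(π∕2)·dist1(a·m⁻¹)∕n`. [folklore] -/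
theorem dist1_seg_succ_le (m a : SU2) {n : ℕ} (hn : 0 < n) (k : ℕ) :
    dist1 (m * expPoint ((((k + 1 : ℕ) : ℝ) / n) • logVec (su2Quat (m⁻¹ * a))) * (m * expPoint ((((k : ℕ) : ℝ) / n) • logVec (su2Quat (m⁻¹ * a))))⁻¹) ≤
      π / 2 * dist1 (a * m⁻¹) / n := by
  have h := dist1_interp_step_le m a (((k + 1 : ℕ) : ℝ) / n) (((k : ℕ) : ℝ) / n)
  have hn' : (0 : ℝ) < n := by exact_mod_cast hn
  have habs : |(((k + 1 : ℕ) : ℝ) / n) - (((k : ℕ) : ℝ) / n)| = 1 / n := by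
    rw [← sub_div, abs_div, abs_of_pos hn']; push_cast; rw [show (k : ℝ) + 1 - k = 1 by ring, abs_one]
  rw [habs] at h
  calc _ ≤ 1 / n * ‖logVec (su2Quat (m⁻¹ * a))‖ := h
    _ ≤ 1 / n * (π / 2 * dist1 (a * m⁻¹)) := mul_le_mul_of_nonneg_left (arc_le_of_dist1 m a) (by positivity)
    _ = π / 2 * dist1 (a * m⁻¹) / n := by ring

/-- ★★ **TWO SEGMENTS ON THE HEMISPHERE, SAME PARAMETER**: for segments `m → a` and `m′ → a′` with all four cross arcs `≤ π∕2` (`m⁻¹a, m⁻¹a′` and `a′⁻¹m, a′⁻¹m′`), at every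
`s ∈ [0,1]` the interpolants satisfy `dist1 ≤ dist1 (a·a′⁻¹) + dist1 (m·m′⁻¹)` — factor ONE (✓`dist1_interp_transverse_le_hemisphere` ∘ ✓`dist1_interp_commonTarget_le_hemisphere`). [cite: Balaban1985RegularSpaces, (1.36) p.82] -/
theorem dist1_seg_seg_le (m a m' a' : SU2) (ha : ‖logVec (su2Quat (m⁻¹ * a))‖ ≤ π / 2) (ha' : ‖logVec (su2Quat (m⁻¹ * a'))‖ ≤ π / 2)
    (hm : ‖logVec (su2Quat (a'⁻¹ * m))‖ ≤ π / 2) (hm' : ‖logVec (su2Quat (a'⁻¹ * m'))‖ ≤ π / 2) {s : ℝ} (hs0 : 0 ≤ s) (hs1 : s ≤ 1) :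
    dist1 (m * expPoint (s • logVec (su2Quat (m⁻¹ * a))) * (m' * expPoint (s • logVec (su2Quat (m'⁻¹ * a'))))⁻¹) ≤
      dist1 (a * a'⁻¹) + dist1 (m * m'⁻¹) := by
  have h1 := dist1_interp_transverse_le_hemisphere m a a' ha ha' hs0 hs1
  have h2 := dist1_interp_commonTarget_le_hemisphere a' m m' hm hm' hs0 hs1
  calc _ ≤ dist1 (m * expPoint (s • logVec (su2Quat (m⁻¹ * a))) * (m * expPoint (s • logVec (su2Quat (m⁻¹ * a'))))⁻¹) +
        dist1 (m * expPoint (s • logVec (su2Quat (m⁻¹ * a'))) * (m' * expPoint (s • logVec (su2Quat (m'⁻¹ * a'))))⁻¹) := by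
        have e : m * expPoint (s • logVec (su2Quat (m⁻¹ * a))) * (m' * expPoint (s • logVec (su2Quat (m'⁻¹ * a'))))⁻¹ =
            (m * expPoint (s • logVec (su2Quat (m⁻¹ * a))) * (m * expPoint (s • logVec (su2Quat (m⁻¹ * a'))))⁻¹) *
            (m * expPoint (s • logVec (su2Quat (m⁻¹ * a'))) * (m' * expPoint (s • logVec (su2Quat (m'⁻¹ * a'))))⁻¹) := by group
        rw [e]; exact GaugeGroup.dist1_mul_le _ _
    _ ≤ _ := add_le_add h1 h2


/-- `dist1 (x·y⁻¹) = dist1 (y·x⁻¹)`. [folklore] -/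
private theorem dist1_mul_inv_comm (x y : SU2) : dist1 (x * y⁻¹) = dist1 (y * x⁻¹) := by
  rw [← GaugeGroup.dist1_inv (x * y⁻¹), mul_inv_rev, inv_inv]

/-- ★★ **TWO SEGMENTS, CHORD FORM** (the transverse step used at every stage): segments `m → a`, `m′ → a′` with `dist1 (a·m⁻¹) ≤ δ`, `dist1 (a′·m′⁻¹) ≤ δ`,
`dist1 (m′·m⁻¹) ≤ ε`, `dist1 (a′·a⁻¹) ≤ ε` and `δ + ε ≤ 1` are, at every common parameter `s ∈ [0,1]`, within `dist1 ≤ 2ε` — factor ONE on the hemisphere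
(all four cross arcs are `≤ (π∕2)·1`). [cite: Balaban1985RegularSpaces, (1.36) p.82] -/
theorem dist1_seg_seg_le_chord (m a m' a' : SU2) {δ ε : ℝ} (hδε : δ + ε ≤ 1) (hε : 0 ≤ ε)
    (h1 : dist1 (a * m⁻¹) ≤ δ) (h2 : dist1 (a' * m'⁻¹) ≤ δ) (h3 : dist1 (m' * m⁻¹) ≤ ε) (h4 : dist1 (a' * a⁻¹) ≤ ε)
    {s : ℝ} (hs0 : 0 ≤ s) (hs1 : s ≤ 1) :
    dist1 (m' * expPoint (s • logVec (su2Quat (m'⁻¹ * a'))) * (m * expPoint (s • logVec (su2Quat (m⁻¹ * a))))⁻¹) ≤ 2 * ε := by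
  have hπ : 0 < π := Real.pi_pos
  have hδ1 : δ ≤ 1 := by linarith
  -- the four cross chords are ≤ 1, hence the four cross arcs are ≤ π/2
  have c1 : dist1 (a' * m'⁻¹) ≤ 1 := h2.trans hδ1
  have c2 : dist1 (a * m'⁻¹) ≤ 1 := by
    have := GaugeGroup.dist1_mul_le (a * a'⁻¹) (a' * m'⁻¹)
    rw [show a * a'⁻¹ * (a' * m'⁻¹) = a * m'⁻¹ by group, dist1_mul_inv_comm a a'] at this
    linarith
  have c3 : dist1 (m' * a⁻¹) ≤ 1 := by rw [dist1_mul_inv_comm]; exact c2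
  have c4 : dist1 (m * a⁻¹) ≤ 1 := by rw [dist1_mul_inv_comm]; exact h1.trans hδ1
  have arc : ∀ x y : SU2, dist1 (y * x⁻¹) ≤ 1 → ‖logVec (su2Quat (x⁻¹ * y))‖ ≤ π / 2 := by
    intro x y h
    calc ‖logVec (su2Quat (x⁻¹ * y))‖ ≤ π / 2 * dist1 (y * x⁻¹) := arc_le_of_dist1 x y
      _ ≤ π / 2 * 1 := mul_le_mul_of_nonneg_left h (by positivity)
      _ = π / 2 := mul_one _
  have h := dist1_seg_seg_le m' a' m a (arc _ _ c1) (arc _ _ c2) (arc _ _ c3) (arc _ _ c4) hs0 hs1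
  calc _ ≤ dist1 (a' * a⁻¹) + dist1 (m' * m⁻¹) := h
    _ ≤ ε + ε := add_le_add h4 h3
    _ = 2 * ε := by ring

/-- ★ **POSITION ALONG A SEGMENT**: the point at parameter `s ∈ [0,1]` is within chord `(π∕2)·dist1(a·m⁻¹)` of the base `m` (arc `s·‖X‖ ≤ ‖X‖ ≤ (π∕2)·chord`). [folklore] -/
theorem dist1_seg_base_le (m a : SU2) {s : ℝ} (hs0 : 0 ≤ s) (hs1 : s ≤ 1) :
    dist1 (m * expPoint (s • logVec (su2Quat (m⁻¹ * a))) * m⁻¹) ≤ π / 2 * dist1 (a * m⁻¹) := by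
  have h := dist1_interp_step_le m a s 0
  rw [zero_smul, T4HaarSU2ExpChart.expPoint_zero, mul_one, sub_zero, abs_of_nonneg hs0] at h
  calc _ ≤ s * ‖logVec (su2Quat (m⁻¹ * a))‖ := h
    _ ≤ 1 * (π / 2 * dist1 (a * m⁻¹)) := mul_le_mul hs1 (arc_le_of_dist1 m a) (norm_nonneg _) zero_le_one
    _ = _ := one_mul _


/-! ## §2 The successive geodesic interpolant of a cube of corner data (an ∃-operator: corner, faces, steps) -/

/-- ★★★ **THE CUBE INTERPOLANT.**  For `0 < n` and `0 ≤ τ ≤ 1∕8` there is an operator `I` sending corner data `T : ℕ → ℕ → ℕ → SU(2)` (read at `{0,1}³`) to a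
function on `{0,…,n}³` with: (corner) `I T 0 0 0 = T 0 0 0`; (faces) `I T n k₁ k₂ = I T(·+1,·,·) 0 k₁ k₂`, `I T k₀ n k₂ = I T(·,·+1,·) k₀ 0 k₂`, `I T k₀ k₁ n = I T(·,·,·+1) k₀ k₁ 0`
(so neighbouring cubes GLUE); (steps) if the twelve edge chords of `T` are `≤ τ` then consecutive points in each of the three directions are within `dist1 ≤ 2π·τ∕n`.
Witness: successive geodesic segments — axis 0, then 1, then 2 (`seg(m,a,k) = m·expPoint((k∕n)•logVec(m⁻¹a))`); factor-one comparisons on the hemisphere (§1).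
[cite: Balaban1985RegularSpaces, Lemma 1 p.79, (1.36) p.82] -/
theorem exists_cubeInterpolant {n : ℕ} (hn : 0 < n) {τ : ℝ} (hτ0 : 0 ≤ τ) (hτ : τ ≤ 1 / 8) :
    ∃ I : (ℕ → ℕ → ℕ → SU2) → ℕ → ℕ → ℕ → SU2, ∀ T : ℕ → ℕ → ℕ → SU2,
      I T 0 0 0 = T 0 0 0 ∧
      (∀ k₁ k₂, I T n k₁ k₂ = I (fun a b c => T (a + 1) b c) 0 k₁ k₂) ∧
      (∀ k₀ k₂, I T k₀ n k₂ = I (fun a b c => T a (b + 1) c) k₀ 0 k₂) ∧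
      (∀ k₀ k₁, I T k₀ k₁ n = I (fun a b c => T a b (c + 1)) k₀ k₁ 0) ∧
      ((∀ b c, dist1 (T 1 b c * (T 0 b c)⁻¹) ≤ τ) → (∀ a c, dist1 (T a 1 c * (T a 0 c)⁻¹) ≤ τ) → (∀ a b, dist1 (T a b 1 * (T a b 0)⁻¹) ≤ τ) →
        ∀ k₀ k₁ k₂, k₀ ≤ n → k₁ ≤ n → k₂ ≤ n →
          (k₀ + 1 ≤ n → dist1 (I T (k₀ + 1) k₁ k₂ * (I T k₀ k₁ k₂)⁻¹) ≤ 2 * π * τ / n) ∧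
          (k₁ + 1 ≤ n → dist1 (I T k₀ (k₁ + 1) k₂ * (I T k₀ k₁ k₂)⁻¹) ≤ 2 * π * τ / n) ∧
          (k₂ + 1 ≤ n → dist1 (I T k₀ k₁ (k₂ + 1) * (I T k₀ k₁ k₂)⁻¹) ≤ 2 * π * τ / n)) := by
  refine ⟨fun (T : ℕ → ℕ → ℕ → SU2) (k₀ k₁ k₂ : ℕ) => (((T 0 0 0 * expPoint ((((k₀ : ℕ) : ℝ) / n) • logVec (su2Quat ((T 0 0 0)⁻¹ * T 1 0 0)))) * expPoint ((((k₁ : ℕ) : ℝ) / n) • logVec (su2Quat (((T 0 0 0 * expPoint ((((k₀ : ℕ) : ℝ) / n) • logVec (su2Quat ((T 0 0 0)⁻¹ * T 1 0 0)))))⁻¹ * (T 0 1 0 * expPoint ((((k₀ : ℕ) : ℝ) / n) • logVec (su2Quat ((T 0 1 0)⁻¹ * T 1 1 0)))))))) * expPoint ((((k₂ : ℕ) : ℝ) / n) • logVec (su2Quat ((((T 0 0 0 * expPoint ((((k₀ : ℕ) : ℝ) / n) • logVec (su2Quat ((T 0 0 0)⁻¹ * T 1 0 0)))) * expPoint ((((k₁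 : ℕ) : ℝ) / n) • logVec (su2Quat (((T 0 0 0 * expPoint ((((k₀ : ℕ) : ℝ) / n) • logVec (su2Quat ((T 0 0 0)⁻¹ * T 1 0 0)))))⁻¹ * (T 0 1 0 * expPoint ((((k₀ : ℕ) : ℝ) / n) • logVec (su2Quat ((T 0 1 0)⁻¹ * T 1 1 0)))))))))⁻¹ * ((T 0 0 1 * expPoint ((((k₀ : ℕ) : ℝ) / n) • logVec (su2Quat ((T 0 0 1)⁻¹ * T 1 0 1)))) * expPoint ((((k₁ : ℕ) : ℝ) / n) • logVec (su2Quat (((T 0 0 1 * expPoint ((((k₀ : ℕ) : ℝ) / n) • logVec (su2Quat ((T 0 0 1)⁻¹ * T 1 0 1)))))⁻¹ * (T 0 1 1 * expPoint ((((k₀ : ℕ) : ℝ) / n) • logVec (su2Quat ((T 0 1 1)⁻¹ * T 1 1 1)))))))))))), fun T => ⟨?_, ?_, ?_, ?_, ?_⟩⟩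
  · simp only [leg_zero]
  · intro k₁ k₂; simp only [leg_end _ _ hn, leg_zero, zero_add]
  · intro k₀ k₂; simp only [leg_end _ _ hn, leg_zero, zero_add]
  · intro k₀ k₁; simp only [leg_end _ _ hn, leg_zero, zero_add]
  intro h0 h1 h2 k₀ k₁ k₂ hk₀ hk₁ hk₂
  have hn' : (0 : ℝ) < n := by exact_mod_cast hn
  have hπ4 : π ≤ 4 := Real.pi_le_four
  have hπ0 : 0 < π := Real.pi_pos
  have h81 : 4 * τ + π * τ ≤ 1 := by nlinarith
  -- parameters in [0,1]
  have s0 : ∀ k : ℕ, (0 : ℝ) ≤ (k : ℝ) / n := fun k => by positivity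
  have s1 : ∀ k : ℕ, k ≤ n → (k : ℝ) / n ≤ 1 := fun k hk => by
    rw [div_le_one hn']; exact_mod_cast hk
  -- STAGE 1 (axis 0): steps `(π/2)τ/n`, positions
  have P_step : ∀ b c k, dist1 ((T 0 b c * expPoint ((((k + 1 : ℕ) : ℝ) / n) • logVec (su2Quat ((T 0 b c)⁻¹ * T 1 b c)))) *
      (T 0 b c * expPoint ((((k : ℕ) : ℝ) / n) • logVec (su2Quat ((T 0 b c)⁻¹ * T 1 b c))))⁻¹) ≤ π / 2 * τ / n := by
    intro b c k
    refine (dist1_seg_succ_le _ _ hn k).trans ?_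
    exact div_le_div_of_nonneg_right (mul_le_mul_of_nonneg_left (h0 b c) (by positivity)) hn'.le
  -- STAGE 2 chords: `dist1 (P 1 c k · (P 0 c k)⁻¹) ≤ 2τ` (axis-1 edges), `dist1 (P b 1 k · (P b 0 k)⁻¹) ≤ 2τ` (axis-2 edges)
  have P_tr1 : ∀ c k, k ≤ n → dist1 ((T 0 1 c * expPoint ((((k : ℕ) : ℝ) / n) • logVec (su2Quat ((T 0 1 c)⁻¹ * T 1 1 c)))) *
      (T 0 0 c * expPoint ((((k : ℕ) : ℝ) / n) • logVec (su2Quat ((T 0 0 c)⁻¹ * T 1 0 c))))⁻¹) ≤ 2 * τ := by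
    intro c k hk
    exact dist1_seg_seg_le_chord (T 0 0 c) (T 1 0 c) (T 0 1 c) (T 1 1 c) (by linarith) hτ0 (h0 0 c) (h0 1 c) (h1 0 c) (h1 1 c) (s0 k) (s1 k hk)
  have P_tr2 : ∀ b k, k ≤ n → dist1 ((T 0 b 1 * expPoint ((((k : ℕ) : ℝ) / n) • logVec (su2Quat ((T 0 b 1)⁻¹ * T 1 b 1)))) *
      (T 0 b 0 * expPoint ((((k : ℕ) : ℝ) / n) • logVec (su2Quat ((T 0 b 0)⁻¹ * T 1 b 0))))⁻¹) ≤ 2 * τ := by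
    intro b k hk
    exact dist1_seg_seg_le_chord (T 0 b 0) (T 1 b 0) (T 0 b 1) (T 1 b 1) (by linarith) hτ0 (h0 b 0) (h0 b 1) (h2 0 b) (h2 1 b) (s0 k) (s1 k hk)

  -- STAGE 2: the chord `Q 1 · (Q 0)⁻¹ ≤ 4τ` and the two steps of `Q c`
  have hQ : ∀ k k', k ≤ n → k' ≤ n →
      dist1 (((T 0 0 1 * expPoint ((((k : ℕ) : ℝ) / n) • logVec (su2Quat ((T 0 0 1)⁻¹ * T 1 0 1)))) * expPoint ((((k' : ℕ) : ℝ) / n) • logVec (su2Quat (((T 0 0 1 * expPoint ((((k : ℕ) : ℝ) / n) • logVec (su2Quat ((T 0 0 1)⁻¹ * T 1 0 1)))))⁻¹ * (T 0 1 1 * expPoint ((((k : ℕ) : ℝ) / n) • logVec (su2Quat ((T 0 1 1)⁻¹ * T 1 1 1)))))))) * (((T 0 0 0 * expPoint ((((k : ℕ) : ℝ) / n) • logVec (su2Quat ((T 0 0 0)⁻¹ * T 1 0 0)))) * expPoint ((((k' : ℕ) : ℝ) / n) • logVec (su2Quat (((T 0 0 0 * expPoint ((((k : ℕ) : ℝ)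 / n) • logVec (su2Quat ((T 0 0 0)⁻¹ * T 1 0 0)))))⁻¹ * (T 0 1 0 * expPoint ((((k : ℕ) : ℝ) / n) • logVec (su2Quat ((T 0 1 0)⁻¹ * T 1 1 0)))))))))⁻¹) ≤ 2 * (2 * τ) := by
    intro k k' hk hk'
    exact dist1_seg_seg_le_chord _ _ _ _ (by linarith) (by linarith) (P_tr1 0 k hk) (P_tr1 1 k hk) (P_tr2 0 k hk) (P_tr2 1 k hk) (s0 k') (s1 k' hk')
  have hQstep1 : ∀ c k k', k ≤ n →
      dist1 (((T 0 0 c * expPoint ((((k : ℕ) : ℝ) / n) • logVec (su2Quat ((T 0 0 c)⁻¹ * T 1 0 c)))) * expPoint ((((k' + 1 : ℕ) : ℝ) / n) • logVec (su2Quat (((T 0 0 c * expPoint ((((k : ℕ) : ℝ) / n) • logVec (su2Quat ((T 0 0 c)⁻¹ * T 1 0 c)))))⁻¹ * (T 0 1 c * expPoint ((((k : ℕ) : ℝ) / n) • logVec (su2Quat ((T 0 1 c)⁻¹ * T 1 1 c)))))))) * (((T 0 0 c * expPoint ((((k : ℕ) : ℝ) / n) • logVec (su2Quat ((T 0 0 c)⁻¹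 * T 1 0 c)))) * expPoint ((((k' : ℕ) : ℝ) / n) • logVec (su2Quat (((T 0 0 c * expPoint ((((k : ℕ) : ℝ) / n) • logVec (su2Quat ((T 0 0 c)⁻¹ * T 1 0 c)))))⁻¹ * (T 0 1 c * expPoint ((((k : ℕ) : ℝ) / n) • logVec (su2Quat ((T 0 1 c)⁻¹ * T 1 1 c)))))))))⁻¹) ≤ π / 2 * (2 * τ) / n := by
    intro c k k' hk
    refine (dist1_seg_succ_le _ _ hn k').trans ?_
    exact div_le_div_of_nonneg_right (mul_le_mul_of_nonneg_left (P_tr1 c k hk) (by positivity)) hn'.le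
  have hQstep0 : ∀ c k k', k + 1 ≤ n → k' ≤ n →
      dist1 (((T 0 0 c * expPoint ((((k + 1 : ℕ) : ℝ) / n) • logVec (su2Quat ((T 0 0 c)⁻¹ * T 1 0 c)))) * expPoint ((((k' : ℕ) : ℝ) / n) • logVec (su2Quat (((T 0 0 c * expPoint ((((k + 1 : ℕ) : ℝ) / n) • logVec (su2Quat ((T 0 0 c)⁻¹ * T 1 0 c)))))⁻¹ * (T 0 1 c * expPoint ((((k + 1 : ℕ) : ℝ) / n) • logVec (su2Quat ((T 0 1 c)⁻¹ * T 1 1 c)))))))) * (((T 0 0 c * expPoint ((((k : ℕ) : ℝ) / n) • logVec (su2Quat ((T 0 0 c)⁻¹ * T 1 0 c)))) * expPoint ((((k' : ℕ) : ℝ) / n) • logVec (su2Quat (((T 0 0 c * expPoint ((((k : ℕ) : ℝ) / n) • logVec (su2Quat ((T 0 0 c)⁻¹ * T 1 0 c)))))⁻¹ * (T 0 1 c * expPoint ((((k : ℕ) : ℝ) / n) • logVec (su2Quat ((T 0 1 c)⁻¹ * T 1 1 c)))))))))⁻¹) ≤ 2 * (π / 2 * τ / n) := by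
    intro c k k' hk hk'
    have hk0 : k ≤ n := by omega
    have hε : 2 * τ + π / 2 * τ / n ≤ 1 := by
      have : π / 2 * τ / n ≤ π / 2 * τ := div_le_self (by positivity) (by exact_mod_cast hn)
      nlinarith
    exact dist1_seg_seg_le_chord _ _ _ _ hε (by positivity) (P_tr1 c k hk0) (P_tr1 c (k + 1) hk) (P_step 0 c k) (P_step 1 c k) (s0 k') (s1 k' hk')
  have hε3 : 2 * (2 * τ) + π / 2 * (2 * τ) / n ≤ 1 := by
    have : π / 2 * (2 * τ) / n ≤ π / 2 * (2 * τ) := div_le_self (by positivity) (by exact_mod_cast hn)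
    nlinarith
  have hε3' : 2 * (2 * τ) + 2 * (π / 2 * τ / n) ≤ 1 := by
    have : π / 2 * τ / n ≤ π / 2 * τ := div_le_self (by positivity) (by exact_mod_cast hn)
    nlinarith
  refine ⟨fun hk0' => ?_, fun hk1' => ?_, fun hk2' => ?_⟩
  · -- axis 0: two segments `Q 0 → Q 1` at `k₀ + 1` vs `k₀`
    beta_reduce
    calc _ ≤ 2 * (2 * (π / 2 * τ / n)) :=
          dist1_seg_seg_le_chord _ _ _ _ hε3' (by positivity) (hQ k₀ k₁ hk₀ hk₁) (hQ (k₀ + 1) k₁ hk0' hk₁)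
            (hQstep0 0 k₀ k₁ hk0' hk₁) (hQstep0 1 k₀ k₁ hk0' hk₁) (s0 k₂) (s1 k₂ hk₂)
      _ = 2 * π * τ / n := by ring
  · -- axis 1: two segments `Q 0 → Q 1` at `k₁ + 1` vs `k₁`
    beta_reduce
    calc _ ≤ 2 * (π / 2 * (2 * τ) / n) :=
          dist1_seg_seg_le_chord _ _ _ _ hε3 (by positivity) (hQ k₀ k₁ hk₀ hk₁) (hQ k₀ (k₁ + 1) hk₀ hk1')
            (hQstep1 0 k₀ k₁ hk₀) (hQstep1 1 k₀ k₁ hk₀) (s0 k₂) (s1 k₂ hk₂)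
      _ = 2 * π * τ / n := by ring
  · -- axis 2: consecutive points of the last segment
    beta_reduce
    calc _ ≤ π / 2 * dist1 (((T 0 0 1 * expPoint ((((k₀ : ℕ) : ℝ) / n) • logVec (su2Quat ((T 0 0 1)⁻¹ * T 1 0 1)))) * expPoint ((((k₁ : ℕ) : ℝ) / n) • logVec (su2Quat (((T 0 0 1 * expPoint ((((k₀ : ℕ) : ℝ) / n) • logVec (su2Quat ((T 0 0 1)⁻¹ * T 1 0 1)))))⁻¹ * (T 0 1 1 * expPoint ((((k₀ : ℕ) : ℝ) / n) • logVec (su2Quat ((T 0 1 1)⁻¹ * T 1 1 1)))))))) * (((T 0 0 0 * expPoint ((((k₀ : ℕ) : ℝ) / n) • logVec (su2Quat ((T 0 0 0)⁻¹ * T 1 0 0)))) * expPoint ((((k₁ : ℕ) : ℝ) / n) • logVec (su2Quat (((T 0 0 0 * expPoint ((((k₀ : ℕ) : ℝ) / n) • logVec (su2Quat ((T 0 0 0)⁻¹ * T 1 0 0)))))⁻¹ * (T 0 1 0 * expPoint ((((k₀ : ℕ) : ℝ) / n) • logVec (su2Quat ((T 0 1 0)⁻¹ * T 1 1 0)))))))))⁻¹)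 / n := dist1_seg_succ_le _ _ hn k₂
      _ ≤ π / 2 * (2 * (2 * τ)) / n := div_le_div_of_nonneg_right (mul_le_mul_of_nonneg_left (hQ k₀ k₁ hk₀ hk₁) (by positivity)) hn'.le
      _ = 2 * π * τ / n := by ring

end Summit.QuantumFields.YangMills.Theorems.FluctuationComparisonRegPrIntLS2BetaCubeInterpolant

end
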